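import Mathlib.Analysis.SpecialFunctions.Integrals.Basic
import Mathlib.Topology.UniformSpace.HeineCantor
import Mathlib.Algebra.Order.Archimedean.Basic
import Mathlib.NumberTheory.Real.Irrational
import Literature.NumberTheory.DiophantineApproximation.WeylCriterionArcs
import HarnessLib

/-!
# Uniform distribution modulo one of a real sequence; Weyl's criterion

Topic `Literature/NumberTheory/UniformDistribution` (definition request `defn-EquidistributedModOne`,
wanted by `route-Schanuel-BenfordTowers`). Everything in this file is PROVED; no named facts.

Source: L. Kuipers, H. Niederreiter, *Uniform distribution of sequences* (Wiley 1974), Chapter 1,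
§§1–2 [KuipersNiederreiter1974]. For a sequence `u : ℕ → ℝ` write `{x} = Int.fract x` and let
`A([a,b); N) = #{n < N : {u n} ∈ [a, b)}` (`fractCount`; K–N index sequences from `1` and count
`1 ≤ n ≤ N`, we index from `0` and count the first `N` terms — the same notion).

* `EquidistributedModOne u` — **Definition 1.1**: `u` is uniformly distributed modulo 1 (u.d. mod 1,
  equidistributed) if `A([a,b); N)/N → b - a` for every `0 ≤ a < b ≤ 1`.
* `EquidistributedModOne.tendsto_fractAvg` — **Theorem 1.1** (⇒): for every real `f` continuous on
  `[0, 1]`, `(1/N) Σ_{n<N} f({u n}) → ∫₀¹ f`; complex-valued version (**Corollary 1.2**)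
  `EquidistributedModOne.tendsto_avg_complex`; the sandwich form behind **Corollary 1.1** (Riemann-
  integrable test functions) is `tendsto_fractAvg_squeeze` / `EquidistributedModOne.tendsto_fractAvg_of_sandwich`.
* `equidistributedModOne_iff_weyl` — **Theorem 2.1 (Weyl's criterion)**: `u` is u.d. mod 1 iff for
  every integer `h ≠ 0`, `Σ_{n<N} e(h u_n) = o(N)` (`e(x) = exp(2πix)`). The Weyl sums are written
  `∑ n ∈ Finset.range N, Complex.exp (2 * Real.pi * Complex.I * (((h : ℝ) * u n : ℝ) : ℂ))`, literally
  the shape inlined by the route items of `Summits/Schanuel/Schanuel/Theses/BenfordTowers.lean` and by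
  `Literature.NumberTheory.Sieve.hooley_polyRoots_equidistributed`, so that specialisation is syntactic.
* `equidistributedModOne_iff_tendsto_fractAvg` — Theorem 1.1 as an equivalence.
* invariances: `EquidistributedModOne.add_const` (K–N Ch. 1, Lemma 1.1: shift by a constant),
  `EquidistributedModOne.congr` (changing the sequence on finitely many / eventually no indices),
  `EquidistributedModOne.comp_add` (dropping the first `k` terms).
* `equidistributedModOne_nat_mul` — **Example 2.1** (Weyl 1916): `(n θ + c)_n` is u.d. mod 1 for
  irrational `θ`.

## Proofs

Theorem 1.1 (⇒) is K–N's proof: approximate `f` uniformly within `ε` by the step function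
`Σ_{j<K} f(j/K)·𝟙[j/K,(j+1)/K)` and sandwich. Weyl's criterion: (⇒) apply Corollary 1.2 to
`e(hx)`, whose integral over `[0,1]` vanishes; (⇐) is the tree's elementary Weyl-criterion-for-arcs
`Literature.NumberTheory.DiophantineApproximation.WeylCircle.tendsto_card_arc_div` (angles
`2π u_n`, arcs `[2πa, 2πb)`), transported to fractional parts with `toIcoMod_eq_add_fract_mul`.

The multidimensional notion (K–N Ch. 1 §6: u.d. mod 1 in `ℝ^s`, Weyl's criterion on the torus,
Kronecker–Weyl for `(nθ₁, …, nθ_s)`) is NOT in this file (sibling file of this directory).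
No Mathlib duplicate: Mathlib (this tree's pin) has no notion of equidistribution of a sequence
(`lean search 'quidistrib'` finds nothing in Mathlib, 2026-08-15); the related Mathlib results are
`AddCircle.denseRange_zsmul_iff` (density, not equidistribution, of `nθ`) and the ergodic theory of
`AddCircle` in `Mathlib.Dynamics.Ergodic.AddCircle`.

## References

* [KuipersNiederreiter1974] L. Kuipers, H. Niederreiter, *Uniform distribution of sequences*, Pure and
  Applied Mathematics, Wiley-Interscience 1974: Ch. 1, Def. 1.1, Thm. 1.1, Cor. 1.1–1.2, Lemma 1.1,
  Thm. 2.1, Example 2.1.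
* [Weyl1916] H. Weyl, *Über die Gleichverteilung von Zahlen mod. Eins*, Math. Ann. 77 (1916) 313–352,
  §1 (Satz 1, the criterion; Satz 2, `nθ`).
-/

noncomputable section

open Filter Topology Asymptotics MeasureTheory

namespace Literature.NumberTheory.UniformDistribution

/-! ### The counting function and the definition -/

/-- Kuipers–Niederreiter's counting function `A([a,b); N)`: the number of indices `n < N` whose term
has fractional part `{u n} ∈ [a, b)`. [cite: KuipersNiederreiter1974, Ch. 1 §1, Def. 1.1] -/
def fractCount (u : ℕ → ℝ) (a b : ℝ) (N : ℕ) : ℕ :=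
  ((Finset.range N).filter fun n => Int.fract (u n) ∈ Set.Ico a b).card

/-- **Uniform distribution modulo 1** (equidistribution mod 1) of a real sequence `u : ℕ → ℝ`:
for every `0 ≤ a < b ≤ 1` the proportion of indices `n < N` with `{u n} ∈ [a, b)` tends to `b - a`
as `N → ∞`. [cite: KuipersNiederreiter1974, Ch. 1, Definition 1.1] -/
def EquidistributedModOne (u : ℕ → ℝ) : Prop :=
  ∀ ⦃a b : ℝ⦄, 0 ≤ a → a < b → b ≤ 1 →
    Tendsto (fun N : ℕ => (fractCount u a b N : ℝ) / N) atTop (𝓝 (b - a))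

/-- The **Weyl sum** `Σ_{n<N} e(h u_n)`, `e(x) = exp(2πix)`, in the literal form used by the route
items (so that `weylSum u h N` unfolds to their inlined sums by `rfl`).
[cite: KuipersNiederreiter1974, Ch. 1 §2, (2.1)] -/
def weylSum (u : ℕ → ℝ) (h : ℤ) (N : ℕ) : ℂ :=
  ∑ n ∈ Finset.range N, Complex.exp (2 * Real.pi * Complex.I * (((h : ℝ) * u n : ℝ) : ℂ))

variable {u : ℕ → ℝ}

/-- `A([a,b); N) ≤ N`. [folklore] -/
theorem fractCount_le (u : ℕ → ℝ) (a b : ℝ) (N : ℕ) : fractCount u a b N ≤ N :=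
  (Finset.card_filter_le _ _).trans (Finset.card_range N).le

/-- `A([a,b); 0) = 0`. [folklore] -/
@[simp] theorem fractCount_zero (u : ℕ → ℝ) (a b : ℝ) : fractCount u a b 0 = 0 := by
  simp [fractCount]

/-- Unfolding lemma for `EquidistributedModOne`. [cite: KuipersNiederreiter1974, Ch. 1, Definition 1.1] -/
theorem equidistributedModOne_iff (u : ℕ → ℝ) :
    EquidistributedModOne u ↔ ∀ ⦃a b : ℝ⦄, 0 ≤ a → a < b → b ≤ 1 →
      Tendsto (fun N : ℕ => (fractCount u a b N : ℝ) / N) atTop (𝓝 (b - a)) :=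
  Iff.rfl

/-! ### Averages along the sequence and the sandwich lemma -/

/-- The averaging functional `g ↦ (1/N) Σ_{n<N} g({u n})` on real test functions. [folklore] -/
def fractAvg (u : ℕ → ℝ) (N : ℕ) (g : ℝ → ℝ) : ℝ :=
  (∑ n ∈ Finset.range N, g (Int.fract (u n))) / N

/-- The average is monotone in the test function (only values on `[0,1)` matter). [folklore] -/
theorem fractAvg_mono (u : ℕ → ℝ) (N : ℕ) {g₁ g₂ : ℝ → ℝ}
    (h : ∀ x ∈ Set.Ico (0 : ℝ) 1, g₁ x ≤ g₂ x) : fractAvg u N g₁ ≤ fractAvg u N g₂ :=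
  div_le_div_of_nonneg_right
    (Finset.sum_le_sum fun n _ => h (Int.fract (u n)) ⟨Int.fract_nonneg _, Int.fract_lt_one _⟩)
    (Nat.cast_nonneg N)

/-- Additivity of the average. [folklore] -/
theorem fractAvg_add (u : ℕ → ℝ) (N : ℕ) (g₁ g₂ : ℝ → ℝ) :
    fractAvg u N (fun x => g₁ x + g₂ x) = fractAvg u N g₁ + fractAvg u N g₂ := by
  simp [fractAvg, Finset.sum_add_distrib, add_div]

/-- The average of a difference. [folklore] -/
theorem fractAvg_sub (u : ℕ → ℝ) (N : ℕ) (g₁ g₂ : ℝ → ℝ) :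
    fractAvg u N (fun x => g₁ x - g₂ x) = fractAvg u N g₁ - fractAvg u N g₂ := by
  simp [fractAvg, Finset.sum_sub_distrib, sub_div]

/-- Homogeneity of the average. [folklore] -/
theorem fractAvg_const_mul (u : ℕ → ℝ) (N : ℕ) (c : ℝ) (g : ℝ → ℝ) :
    fractAvg u N (fun x => c * g x) = c * fractAvg u N g := by
  simp [fractAvg, ← Finset.mul_sum, mul_div_assoc]

/-- The average of a finite sum of test functions. [folklore] -/
theorem fractAvg_finset_sum (u : ℕ → ℝ) (N : ℕ) {ι : Type*} (s : Finset ι) (g : ι → ℝ → ℝ) :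
    fractAvg u N (fun x => ∑ i ∈ s, g i x) = ∑ i ∈ s, fractAvg u N (g i) := by
  simp only [fractAvg]
  rw [Finset.sum_comm, Finset.sum_div]

/-- The average of a constant is the constant (for `N ≠ 0`). [folklore] -/
theorem fractAvg_const (u : ℕ → ℝ) {N : ℕ} (hN : N ≠ 0) (c : ℝ) : fractAvg u N (fun _ => c) = c := by
  have : (N : ℝ) ≠ 0 := Nat.cast_ne_zero.2 hN
  simp [fractAvg, this]

/-- The average of the indicator of `[a, b)` is the counting frequency `A([a,b); N)/N`. [folklore] -/
theorem fractAvg_indicator (u : ℕ → ℝ) (N : ℕ) (a b : ℝ) :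
    fractAvg u N (Set.indicator (Set.Ico a b) 1) = (fractCount u a b N : ℝ) / N := by
  unfold fractAvg fractCount
  rw [Finset.natCast_card_filter]
  congr 1
  refine Finset.sum_congr rfl fun n _ => ?_
  by_cases h : Int.fract (u n) ∈ Set.Ico a b <;> simp [h]

/-- **Sandwich lemma** (the mechanism of K–N Ch. 1, Cor. 1.1): if for every `ε > 0` the test
function `f` is squeezed on `[0, 1)` between two test functions whose averages along `u` converge to
limits within `ε` of `L`, then the averages of `f` converge to `L`. [folklore] -/
theorem tendsto_fractAvg_squeeze (u : ℕ → ℝ) {f : ℝ → ℝ} {L : ℝ}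
    (h : ∀ ε > 0, ∃ (g₁ g₂ : ℝ → ℝ) (L₁ L₂ : ℝ),
      (∀ x ∈ Set.Ico (0 : ℝ) 1, g₁ x ≤ f x) ∧ (∀ x ∈ Set.Ico (0 : ℝ) 1, f x ≤ g₂ x) ∧
      Tendsto (fun N => fractAvg u N g₁) atTop (𝓝 L₁) ∧
      Tendsto (fun N => fractAvg u N g₂) atTop (𝓝 L₂) ∧ L - ε ≤ L₁ ∧ L₂ ≤ L + ε) :
    Tendsto (fun N => fractAvg u N f) atTop (𝓝 L) := by
  refine tendsto_order.2 ⟨fun c hc => ?_, fun c hc => ?_⟩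
  · obtain ⟨g₁, g₂, L₁, L₂, hg₁, -, h₁, -, hL₁, -⟩ := h ((L - c) / 2) (by linarith)
    have hc' : c < L₁ := by linarith
    filter_upwards [(tendsto_order.1 h₁).1 c hc'] with N hN
    exact hN.trans_le (fractAvg_mono u N hg₁)
  · obtain ⟨g₁, g₂, L₁, L₂, -, hg₂, -, h₂, -, hL₂⟩ := h ((c - L) / 2) (by linarith)
    have hc' : L₂ < c := by linarith
    filter_upwards [(tendsto_order.1 h₂).2 c hc'] with N hN
    exact (fractAvg_mono u N hg₂).trans_lt hN

/-- The grid cell `[j/K, (j+1)/K)` containing `x ≥ 0` is the one with `j = ⌊Kx⌋`. [folklore] -/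
theorem mem_Ico_div_iff {K : ℕ} (hK : 0 < K) {x : ℝ} (hx : 0 ≤ x) (j : ℕ) :
    x ∈ Set.Ico ((j : ℝ) / K) ((j + 1) / K) ↔ ⌊(K : ℝ) * x⌋₊ = j := by
  have hK' : (0 : ℝ) < K := Nat.cast_pos.2 hK
  rw [Nat.floor_eq_iff (by positivity), Set.mem_Ico, div_le_iff₀ hK', lt_div_iff₀ hK', mul_comm x]

/-! ### Theorem 1.1: continuous test functions -/

/-- **K–N Theorem 1.1 (⇒).** If `u` is u.d. mod 1 then for every real-valued `f` continuous on
`[0, 1]`, `(1/N) Σ_{n<N} f({u n}) → ∫₀¹ f(x) dx`. [cite: KuipersNiederreiter1974, Ch. 1, Theorem 1.1] -/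
theorem EquidistributedModOne.tendsto_fractAvg (hu : EquidistributedModOne u) {f : ℝ → ℝ}
    (hf : ContinuousOn f (Set.Icc 0 1)) :
    Tendsto (fun N => fractAvg u N f) atTop (𝓝 (∫ x in (0 : ℝ)..1, f x)) := by
  refine tendsto_fractAvg_squeeze u fun ε hε => ?_
  have hε2 : 0 < ε / 2 := half_pos hε
  -- uniform continuity of `f` on `[0, 1]`
  obtain ⟨δ, hδ, hUC⟩ := Metric.uniformContinuousOn_iff_le.1
    (isCompact_Icc.uniformContinuousOn_of_continuous hf) (ε / 2) hε2
  obtain ⟨K₀, hK₀⟩ := exists_nat_one_div_lt hδ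
  set K : ℕ := K₀ + 1 with hKdef
  have hK : 0 < K := Nat.succ_pos _
  have hKr : (0 : ℝ) < K := Nat.cast_pos.2 hK
  have hKδ : 1 / (K : ℝ) < δ := by simpa [hKdef] using hK₀
  -- the step function `Σ_{j<K} f(j/K) 𝟙[j/K,(j+1)/K)`
  set c : ℕ → ℝ := fun j => f (j / K) with hc
  set step : ℝ → ℝ := fun x =>
    ∑ j ∈ Finset.range K, c j * Set.indicator (Set.Ico ((j : ℝ) / K) ((j + 1) / K)) 1 x with hstep
  -- on `[0,1)` the step function is `f(⌊Kx⌋/K)`, within `ε/2` of `f x`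
  have hstep_eq : ∀ x ∈ Set.Ico (0 : ℝ) 1, step x = c ⌊(K : ℝ) * x⌋₊ := by
    intro x hx
    have hj₀ : ⌊(K : ℝ) * x⌋₊ ∈ Finset.range K := by
      rw [Finset.mem_range, Nat.floor_lt (mul_nonneg hKr.le hx.1)]
      calc (K : ℝ) * x < K * 1 := mul_lt_mul_of_pos_left hx.2 hKr
        _ = K := mul_one _
    rw [hstep]
    dsimp only
    rw [Finset.sum_eq_single_of_mem _ hj₀]
    · rw [Set.indicator_of_mem ((mem_Ico_div_iff hK hx.1 _).2 rfl), Pi.one_apply, mul_one]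
    · intro j _ hne
      rw [Set.indicator_of_notMem, mul_zero]
      exact fun hmem => hne ((mem_Ico_div_iff hK hx.1 _).1 hmem).symm
  have hclose : ∀ x ∈ Set.Ico (0 : ℝ) 1, |f x - step x| ≤ ε / 2 := by
    intro x hx
    rw [hstep_eq x hx, hc]
    dsimp only
    have h1 : ((⌊(K : ℝ) * x⌋₊ : ℝ)) / K ≤ x := by
      rw [div_le_iff₀ hKr, mul_comm x]
      exact Nat.floor_le (mul_nonneg hKr.le hx.1)
    have h2 : x < ((⌊(K : ℝ) * x⌋₊ : ℝ) + 1) / K := by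
      rw [lt_div_iff₀ hKr, mul_comm x]
      exact Nat.lt_floor_add_one _
    have hdist : dist x (((⌊(K : ℝ) * x⌋₊ : ℝ)) / K) ≤ δ := by
      rw [Real.dist_eq, abs_of_nonneg (by linarith)]
      have : ((⌊(K : ℝ) * x⌋₊ : ℝ) + 1) / K = (⌊(K : ℝ) * x⌋₊ : ℝ) / K + 1 / K := by ring
      linarith
    have hxI : x ∈ Set.Icc (0 : ℝ) 1 := ⟨hx.1, hx.2.le⟩
    have hyI : ((⌊(K : ℝ) * x⌋₊ : ℝ)) / K ∈ Set.Icc (0 : ℝ) 1 :=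
      ⟨by positivity, h1.trans hx.2.le⟩
    have := hUC x hxI _ hyI hdist
    rwa [Real.dist_eq] at this
  -- the averages of the step function converge to `S = Σ_j f(j/K)/K`
  set S : ℝ := ∑ j ∈ Finset.range K, c j * (1 / K) with hS
  have havg : Tendsto (fun N => fractAvg u N step) atTop (𝓝 S) := by
    have hrw : ∀ N, fractAvg u N step =
        ∑ j ∈ Finset.range K, c j * ((fractCount u (j / K) ((j + 1) / K) N : ℝ) / N) := by
      intro N
      rw [hstep, fractAvg_finset_sum]
      refine Finset.sum_congr rfl fun j _ => ?_
      rw [fractAvg_const_mul, fractAvg_indicator]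
    simp_rw [hrw]
    refine tendsto_finsetSum _ fun j hj => Tendsto.const_mul (c j) ?_
    have hjK : j + 1 ≤ K := Finset.mem_range.1 hj
    have h := hu (a := j / K) (b := (j + 1) / K) (by positivity)
      (div_lt_div_of_pos_right (lt_add_one _) hKr)
      ((div_le_one hKr).2 (by exact_mod_cast hjK))
    rwa [show ((j : ℝ) + 1) / K - j / K = 1 / K by ring] at h
  -- `|S - ∫₀¹ f| ≤ ε/2`
  have hint : |S - ∫ x in (0 : ℝ)..1, f x| ≤ ε / 2 := by
    have hfi : ∀ k < K, IntervalIntegrable f volume ((k : ℝ) / K) ((k + 1 : ℕ) / K) := by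
      intro k hk
      refine (hf.mono ?_).intervalIntegrable_of_Icc
        (div_le_div_of_nonneg_right (by exact_mod_cast (Nat.le_succ k)) hKr.le)
      refine Set.Icc_subset_Icc (by positivity) ((div_le_one hKr).2 ?_)
      exact_mod_cast Nat.succ_le_of_lt hk
    have hsplit := intervalIntegral.sum_integral_adjacent_intervals hfi
    simp only [Nat.cast_zero, zero_div, div_self hKr.ne'] at hsplit
    rw [← hsplit, hS, ← Finset.sum_sub_distrib]
    have hterm : ∀ j ∈ Finset.range K,
        |c j * (1 / K) - ∫ x in ((j : ℝ) / K)..((j + 1 : ℕ) / K), f x| ≤ ε / 2 * (1 / K) := by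
      intro j hj
      have hjK : j + 1 ≤ K := Finset.mem_range.1 hj
      have hle : (j : ℝ) / K ≤ (j + 1 : ℕ) / K :=
        div_le_div_of_nonneg_right (by exact_mod_cast (Nat.le_succ j)) hKr.le
      have hcint : c j * (1 / K) = ∫ _ in ((j : ℝ) / K)..((j + 1 : ℕ) / K), c j := by
        rw [intervalIntegral.integral_const, smul_eq_mul]
        push_cast
        ring
      rw [hcint, ← intervalIntegral.integral_sub intervalIntegrable_const (hfi j hjK)]
      have hb := intervalIntegral.norm_integral_le_of_norm_le_const (a := (j : ℝ) / K)
        (b := ((j + 1 : ℕ) : ℝ) / K) (f := fun x => c j - f x) (C := ε / 2) ?_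
      · rw [Real.norm_eq_abs] at hb
        refine hb.trans (le_of_eq ?_)
        rw [abs_of_nonneg (by linarith)]
        push_cast
        ring
      · intro x hx
        rw [Set.uIoc_of_le hle] at hx
        push_cast at hx
        have hx0 : 0 ≤ x := le_trans (by positivity) hx.1.le
        have hx1 : x ≤ 1 := hx.2.trans ((div_le_one hKr).2 (by exact_mod_cast hjK))
        have hdist : dist ((j : ℝ) / K) x ≤ δ := by
          rw [Real.dist_eq, abs_of_nonpos (by linarith [hx.1])]
          have : ((j : ℝ) + 1) / K = (j : ℝ) / K + 1 / K := by ring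
          linarith [hx.2]
        have hyI : (j : ℝ) / K ∈ Set.Icc (0 : ℝ) 1 :=
          ⟨by positivity, hx.1.le.trans hx1⟩
        have := hUC _ hyI x ⟨hx0, hx1⟩ hdist
        rwa [Real.dist_eq, Real.norm_eq_abs] at *
    calc |∑ j ∈ Finset.range K, (c j * (1 / K) - ∫ x in ((j : ℝ) / K)..((j + 1 : ℕ) / K), f x)|
        ≤ ∑ j ∈ Finset.range K, |c j * (1 / K) - ∫ x in ((j : ℝ) / K)..((j + 1 : ℕ) / K), f x| :=
          Finset.abs_sum_le_sum_abs _ _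
      _ ≤ ∑ _j ∈ Finset.range K, ε / 2 * (1 / K) := Finset.sum_le_sum hterm
      _ = ε / 2 := by
          rw [Finset.sum_const, Finset.card_range, nsmul_eq_mul]
          field_simp
  -- the sandwich `step - ε/2 ≤ f ≤ step + ε/2` on `[0, 1)`
  refine ⟨fun x => step x - ε / 2, fun x => step x + ε / 2, S - ε / 2, S + ε / 2,
    fun x hx => ?_, fun x hx => ?_, ?_, ?_, ?_, ?_⟩
  · have := hclose x hx; rw [abs_le] at this; linarith
  · have := hclose x hx; rw [abs_le] at this; linarith
  · refine (havg.sub_const (ε / 2)).congr' ?_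
    filter_upwards [eventually_ne_atTop 0] with N hN
    rw [fractAvg_sub, fractAvg_const u hN]
  · refine (havg.add_const (ε / 2)).congr' ?_
    filter_upwards [eventually_ne_atTop 0] with N hN
    rw [fractAvg_add, fractAvg_const u hN]
  · rw [abs_le] at hint; linarith
  · rw [abs_le] at hint; linarith

/-- **K–N Corollary 1.1, sandwich form.** If `u` is u.d. mod 1 and the real test function `f` can,
for every `ε > 0`, be squeezed on `[0,1)` between functions `g₁ ≤ f ≤ g₂` continuous on `[0,1]` with
`L - ε ≤ ∫₀¹ g₁` and `∫₀¹ g₂ ≤ L + ε`, then `(1/N) Σ_{n<N} f({u n}) → L`. (For a Riemann-integrable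
`f` this holds with `L = ∫₀¹ f`, which is how K–N prove Cor. 1.1; indicators of subintervals are the
case of Def. 1.1.) [cite: KuipersNiederreiter1974, Ch. 1, Corollary 1.1] -/
theorem EquidistributedModOne.tendsto_fractAvg_of_sandwich (hu : EquidistributedModOne u)
    {f : ℝ → ℝ} {L : ℝ}
    (h : ∀ ε > 0, ∃ g₁ g₂ : ℝ → ℝ, ContinuousOn g₁ (Set.Icc 0 1) ∧ ContinuousOn g₂ (Set.Icc 0 1) ∧
      (∀ x ∈ Set.Ico (0 : ℝ) 1, g₁ x ≤ f x) ∧ (∀ x ∈ Set.Ico (0 : ℝ) 1, f x ≤ g₂ x) ∧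
      L - ε ≤ ∫ x in (0 : ℝ)..1, g₁ x ∧ ∫ x in (0 : ℝ)..1, g₂ x ≤ L + ε) :
    Tendsto (fun N => fractAvg u N f) atTop (𝓝 L) := by
  refine tendsto_fractAvg_squeeze u fun ε hε => ?_
  obtain ⟨g₁, g₂, hg₁, hg₂, h₁, h₂, hL₁, hL₂⟩ := h ε hε
  exact ⟨g₁, g₂, _, _, h₁, h₂, hu.tendsto_fractAvg hg₁, hu.tendsto_fractAvg hg₂, hL₁, hL₂⟩

/-- **K–N Corollary 1.2 (complex-valued test functions).** If `u` is u.d. mod 1 then for every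
`f : ℝ → ℂ` continuous on `[0, 1]`, `(1/N) Σ_{n<N} f({u n}) → ∫₀¹ f`. (K–N state it for continuous
`1`-periodic `f` on `ℝ`, for which `f({u n}) = f(u n)`.) [cite: KuipersNiederreiter1974, Ch. 1, Corollary 1.2] -/
theorem EquidistributedModOne.tendsto_avg_complex (hu : EquidistributedModOne u) {f : ℝ → ℂ}
    (hf : ContinuousOn f (Set.Icc 0 1)) :
    Tendsto (fun N : ℕ => (∑ n ∈ Finset.range N, f (Int.fract (u n))) / (N : ℂ)) atTop
      (𝓝 (∫ x in (0 : ℝ)..1, f x)) := by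
  have hre := hu.tendsto_fractAvg (Complex.continuous_re.comp_continuousOn hf)
  have him := hu.tendsto_fractAvg (Complex.continuous_im.comp_continuousOn hf)
  have hfi : IntervalIntegrable f volume 0 1 := hf.intervalIntegrable_of_Icc zero_le_one
  have h1 : ∫ x in (0 : ℝ)..1, (f x).re = (∫ x in (0 : ℝ)..1, f x).re := by
    simpa using intervalIntegral.intervalIntegral_re hfi
  have h2 : ∫ x in (0 : ℝ)..1, (f x).im = (∫ x in (0 : ℝ)..1, f x).im := by
    simpa using intervalIntegral.intervalIntegral_im hfi
  have hlim : Tendsto (fun N : ℕ => ((fractAvg u N fun x => (f x).re : ℝ) : ℂ) +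
      ((fractAvg u N fun x => (f x).im : ℝ) : ℂ) * Complex.I) atTop
      (𝓝 (((∫ x in (0 : ℝ)..1, f x).re : ℂ) + ((∫ x in (0 : ℝ)..1, f x).im : ℂ) * Complex.I)) := by
    rw [← h1, ← h2]
    exact ((Complex.continuous_ofReal.tendsto _).comp hre).add
      (((Complex.continuous_ofReal.tendsto _).comp him).mul_const Complex.I)
  rw [Complex.re_add_im] at hlim
  refine hlim.congr fun N => ?_
  apply Complex.ext
  · simp [fractAvg, Complex.re_sum]
  · simp [fractAvg, Complex.im_sum]

/-! ### Theorem 2.1: Weyl's criterion -/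

/-- `e(h x)` only depends on `x` modulo `1`: `e(h u) = e(h {u})` for an integer `h`. [folklore] -/
theorem exp_two_pi_mul_int_mul_eq_fract (h : ℤ) (x : ℝ) :
    Complex.exp (2 * Real.pi * Complex.I * (((h : ℝ) * x : ℝ) : ℂ)) =
      Complex.exp (2 * Real.pi * Complex.I * (((h : ℝ) * Int.fract x : ℝ) : ℂ)) := by
  have hx : (h : ℝ) * x = (h : ℝ) * Int.fract x + ((h * ⌊x⌋ : ℤ) : ℝ) := by
    rw [Int.fract]
    push_cast
    ring
  rw [hx]
  push_cast
  rw [mul_add, Complex.exp_add]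
  have h1 : Complex.exp (2 * Real.pi * Complex.I * ((h : ℂ) * (⌊x⌋ : ℂ))) = 1 := by
    have : 2 * Real.pi * Complex.I * ((h : ℂ) * (⌊x⌋ : ℂ)) = ((h * ⌊x⌋ : ℤ) : ℂ) * (2 * Real.pi * Complex.I) := by
      push_cast; ring
    rw [this]
    exact Complex.exp_int_mul_two_pi_mul_I _
  rw [h1, mul_one]

/-- `∫₀¹ e(h x) dx = 0` for an integer `h ≠ 0`. [folklore] -/
theorem integral_exp_two_pi_mul_int_mul {h : ℤ} (hh : h ≠ 0) :
    ∫ x in (0 : ℝ)..1, Complex.exp (2 * Real.pi * Complex.I * (((h : ℝ) * x : ℝ) : ℂ)) = 0 := by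
  set c : ℂ := 2 * Real.pi * Complex.I * h with hc
  have hc0 : c ≠ 0 := by
    rw [hc]
    refine mul_ne_zero (mul_ne_zero (mul_ne_zero two_ne_zero ?_) Complex.I_ne_zero) ?_
    · exact_mod_cast Real.pi_ne_zero
    · exact_mod_cast hh
  have hrw : (fun x : ℝ => Complex.exp (2 * Real.pi * Complex.I * (((h : ℝ) * x : ℝ) : ℂ))) =
      fun x : ℝ => Complex.exp (c * x) := by
    funext x; rw [hc]; push_cast; ring_nf
  rw [hrw, integral_exp_mul_complex hc0]
  have h1 : Complex.exp c = 1 := by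
    rw [hc, show 2 * Real.pi * Complex.I * (h : ℂ) = (h : ℂ) * (2 * Real.pi * Complex.I) by ring]
    exact Complex.exp_int_mul_two_pi_mul_I h
  simp [h1]

/-- **Weyl's criterion (⇒), K–N Theorem 2.1.** If `u` is u.d. mod 1 then for every integer `h ≠ 0`
the Weyl sums are `o(N)`: `Σ_{n<N} e(h u_n) = o(N)`. [cite: KuipersNiederreiter1974, Ch. 1, Theorem 2.1] -/
theorem EquidistributedModOne.isLittleO_weylSum (hu : EquidistributedModOne u) {h : ℤ} (hh : h ≠ 0) :
    (fun N : ℕ => ∑ n ∈ Finset.range N,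
        Complex.exp (2 * Real.pi * Complex.I * (((h : ℝ) * u n : ℝ) : ℂ))) =o[atTop]
      fun N : ℕ => (N : ℝ) := by
  set F : ℝ → ℂ := fun x => Complex.exp (2 * Real.pi * Complex.I * (((h : ℝ) * x : ℝ) : ℂ)) with hF
  have hFc : ContinuousOn F (Set.Icc 0 1) := by
    rw [hF]
    fun_prop
  have hlim := hu.tendsto_avg_complex hFc
  rw [hF, integral_exp_two_pi_mul_int_mul hh] at hlim
  have h1 : (fun N : ℕ => ∑ n ∈ Finset.range N,
      Complex.exp (2 * Real.pi * Complex.I * (((h : ℝ) * u n : ℝ) : ℂ))) =o[atTop]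
      fun N : ℕ => (N : ℂ) := by
    refine (Asymptotics.isLittleO_iff_tendsto' ?_).2 ?_
    · filter_upwards [eventually_ne_atTop 0] with N hN hN0
      exact absurd (by exact_mod_cast hN0 : N = 0) hN
    · refine hlim.congr fun N => ?_
      simp only [exp_two_pi_mul_int_mul_eq_fract h (u _)]
  exact h1.norm_right.congr_right fun N => Complex.norm_natCast N

/-- For `0 ≤ a < b ≤ 1`: `{x - a} < b - a ↔ {x} ∈ [a, b)`. [folklore] -/
theorem fract_sub_lt_iff {a b : ℝ} (ha : 0 ≤ a) (hab : a < b) (hb : b ≤ 1) (x : ℝ) :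
    Int.fract (x - a) < b - a ↔ Int.fract x ∈ Set.Ico a b := by
  have hy0 := Int.fract_nonneg x
  have hy1 := Int.fract_lt_one x
  have hxa : Int.fract (x - a) = Int.fract (Int.fract x - a) := by
    conv_lhs => rw [← Int.floor_add_fract x, add_sub_assoc, Int.fract_intCast_add]
  rw [hxa]
  rcases le_or_gt a (Int.fract x) with hya | hya
  · rw [Int.fract_eq_self.2 ⟨by linarith, by linarith⟩, Set.mem_Ico]
    constructor
    · intro h; exact ⟨hya, by linarith⟩
    · intro h; linarith [h.2]
  · have h1 : Int.fract (Int.fract x - a) = Int.fract x - a + 1 := by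
      rw [← Int.fract_add_one, Int.fract_eq_self.2 ⟨by linarith, by linarith⟩]
    rw [h1, Set.mem_Ico]
    constructor
    · intro h; linarith
    · intro h; linarith [h.1]

/-- **Weyl's criterion (⇐), K–N Theorem 2.1.** If `Σ_{n<N} e(h u_n) = o(N)` for every integer
`h ≠ 0`, then `u` is u.d. mod 1. (Proof: the tree's Weyl criterion for arcs,
`WeylCircle.tendsto_card_arc_div`, with angles `2π u_n`.) [cite: KuipersNiederreiter1974, Ch. 1, Theorem 2.1] -/
theorem equidistributedModOne_of_isLittleO_weylSum
    (hW : ∀ h : ℤ, h ≠ 0 → (fun N : ℕ => ∑ n ∈ Finset.range N,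
        Complex.exp (2 * Real.pi * Complex.I * (((h : ℝ) * u n : ℝ) : ℂ))) =o[atTop]
      fun N : ℕ => (N : ℝ)) :
    EquidistributedModOne u := by
  intro a b ha hab hb
  have hπ := Real.pi_pos
  have h0 : Tendsto (fun N : ℕ => (Finset.range N).card) atTop atTop := by
    simp only [Finset.card_range]
    exact tendsto_id
  have hW' : ∀ k : ℤ, k ≠ 0 → (fun N : ℕ => ∑ n ∈ Finset.range N,
      Complex.exp (k * ((2 * Real.pi * u n : ℝ) : ℂ) * Complex.I)) =o[atTop]
      fun N : ℕ => ((Finset.range N).card : ℝ) := by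
    intro k hk
    simp only [Finset.card_range]
    refine (hW k hk).congr_left fun N => Finset.sum_congr rfl fun n _ => ?_
    congr 1
    push_cast
    ring
  have key := Literature.NumberTheory.DiophantineApproximation.WeylCircle.tendsto_card_arc_div
    (fun N => Finset.range N) (fun n => 2 * Real.pi * u n) h0 hW' (2 * Real.pi * a)
    (α := 2 * Real.pi * (b - a)) (by nlinarith) (by nlinarith)
  simp only [Finset.card_range] at key
  rw [show 2 * Real.pi * (b - a) / (2 * Real.pi) = b - a by field_simp] at key
  refine key.congr fun N => ?_
  unfold fractCount
  congr 3
  refine Finset.filter_congr fun n _ => ?_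
  rw [toIcoMod_eq_add_fract_mul, ← fract_sub_lt_iff ha hab hb,
    show (2 * Real.pi * u n - 2 * Real.pi * a) / (2 * Real.pi) = u n - a by
      rw [← mul_sub, mul_div_cancel_left₀ _ (by positivity)]]
  constructor
  · intro h; nlinarith [Int.fract_nonneg (u n - a)]
  · intro h; nlinarith

/-- **Weyl's criterion, K–N Theorem 2.1.** A real sequence `u` is u.d. mod 1 if and only if
`Σ_{n<N} e(h u_n) = o(N)` for every integer `h ≠ 0` (the Weyl sums written out as the route items
of `Summits/Schanuel/Schanuel/Theses/BenfordTowers.lean` inline them).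
[cite: KuipersNiederreiter1974, Ch. 1, Theorem 2.1] -/
theorem equidistributedModOne_iff_weyl (u : ℕ → ℝ) :
    EquidistributedModOne u ↔ ∀ h : ℤ, h ≠ 0 → (fun N : ℕ => ∑ n ∈ Finset.range N,
        Complex.exp (2 * Real.pi * Complex.I * (((h : ℝ) * u n : ℝ) : ℂ))) =o[atTop]
      fun N : ℕ => (N : ℝ) :=
  ⟨fun hu _ hh => hu.isLittleO_weylSum hh, equidistributedModOne_of_isLittleO_weylSum⟩

/-- Weyl's criterion phrased with `weylSum`. [cite: KuipersNiederreiter1974, Ch. 1, Theorem 2.1] -/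
theorem equidistributedModOne_iff_isLittleO_weylSum (u : ℕ → ℝ) :
    EquidistributedModOne u ↔ ∀ h : ℤ, h ≠ 0 → (weylSum u h) =o[atTop] fun N : ℕ => (N : ℝ) :=
  equidistributedModOne_iff_weyl u

/-- **K–N Theorem 1.1 as an equivalence**: `u` is u.d. mod 1 iff `(1/N) Σ_{n<N} f({u n}) → ∫₀¹ f`
for every real-valued `f` continuous on `[0, 1]`. (⇐: apply the hypothesis to `cos(2πh·)` and
`sin(2πh·)` — packaged as Weyl's criterion.) [cite: KuipersNiederreiter1974, Ch. 1, Theorem 1.1] -/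
theorem equidistributedModOne_iff_tendsto_fractAvg (u : ℕ → ℝ) :
    EquidistributedModOne u ↔ ∀ f : ℝ → ℝ, ContinuousOn f (Set.Icc 0 1) →
      Tendsto (fun N => fractAvg u N f) atTop (𝓝 (∫ x in (0 : ℝ)..1, f x)) := by
  refine ⟨fun hu f hf => hu.tendsto_fractAvg hf, fun H => ?_⟩
  -- indicators of `[a,b)` are sandwiched by nothing here: go through Weyl's criterion instead,
  -- using the real and imaginary parts of `e(hx)`.
  refine equidistributedModOne_of_isLittleO_weylSum fun h hh => ?_
  set F : ℝ → ℂ := fun x => Complex.exp (2 * Real.pi * Complex.I * (((h : ℝ) * x : ℝ) : ℂ)) with hF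
  have hFc : Continuous F := by rw [hF]; fun_prop
  have hre := H _ (Complex.continuous_re.comp hFc).continuousOn
  have him := H _ (Complex.continuous_im.comp hFc).continuousOn
  have hfi : IntervalIntegrable F volume 0 1 := hFc.intervalIntegrable _ _
  have h1 : ∫ x in (0 : ℝ)..1, (F x).re = 0 := by
    have := intervalIntegral.intervalIntegral_re hfi
    simp only [RCLike.re_to_complex] at this
    rw [this, hF]
    simp only [integral_exp_two_pi_mul_int_mul hh, Complex.zero_re]
  have h2 : ∫ x in (0 : ℝ)..1, (F x).im = 0 := by
    have := intervalIntegral.intervalIntegral_im hfi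
    simp only [RCLike.im_to_complex] at this
    rw [this, hF]
    simp only [integral_exp_two_pi_mul_int_mul hh, Complex.zero_im]
  simp only [Function.comp_def] at hre him
  rw [h1] at hre
  rw [h2] at him
  have hlim : Tendsto (fun N : ℕ => ((fractAvg u N fun x => (F x).re : ℝ) : ℂ) +
      ((fractAvg u N fun x => (F x).im : ℝ) : ℂ) * Complex.I) atTop (𝓝 ((0 : ℝ) + (0 : ℝ) * Complex.I)) :=
    ((Complex.continuous_ofReal.tendsto _).comp hre).add
      (((Complex.continuous_ofReal.tendsto _).comp him).mul_const Complex.I)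
  simp only [Complex.ofReal_zero, zero_mul, add_zero] at hlim
  have h3 : (fun N : ℕ => ∑ n ∈ Finset.range N,
      Complex.exp (2 * Real.pi * Complex.I * (((h : ℝ) * u n : ℝ) : ℂ))) =o[atTop]
      fun N : ℕ => (N : ℂ) := by
    refine (Asymptotics.isLittleO_iff_tendsto' ?_).2 ?_
    · filter_upwards [eventually_ne_atTop 0] with N hN hN0
      exact absurd (by exact_mod_cast hN0 : N = 0) hN
    · refine hlim.congr fun N => ?_
      rw [Finset.sum_congr rfl fun n _ => exp_two_pi_mul_int_mul_eq_fract h (u n)]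
      apply Complex.ext
      · simp [fractAvg, Complex.re_sum, hF]
      · simp [fractAvg, Complex.im_sum, hF]
  exact h3.norm_right.congr_right fun N => Complex.norm_natCast N

/-! ### Invariances -/

/-- **Shift by a constant** (K–N Ch. 1, Lemma 1.1): if `u` is u.d. mod 1, so is `(u n + c)_n`.
[cite: KuipersNiederreiter1974, Ch. 1, Lemma 1.1] -/
theorem EquidistributedModOne.add_const (hu : EquidistributedModOne u) (c : ℝ) :
    EquidistributedModOne fun n => u n + c := by
  rw [equidistributedModOne_iff_weyl] at hu ⊢
  intro h hh
  have hrw : (fun N : ℕ => ∑ n ∈ Finset.range N,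
      Complex.exp (2 * Real.pi * Complex.I * (((h : ℝ) * (u n + c) : ℝ) : ℂ))) =
      fun N : ℕ => Complex.exp (2 * Real.pi * Complex.I * (((h : ℝ) * c : ℝ) : ℂ)) *
        ∑ n ∈ Finset.range N, Complex.exp (2 * Real.pi * Complex.I * (((h : ℝ) * u n : ℝ) : ℂ)) := by
    funext N
    rw [Finset.mul_sum]
    refine Finset.sum_congr rfl fun n _ => ?_
    rw [← Complex.exp_add]
    congr 1
    push_cast
    ring
  rw [hrw]
  exact (hu h hh).const_mul_left _

/-- **Changing the sequence on a set of indices that is eventually empty** (in particular on finitely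
many indices) preserves u.d. mod 1. [folklore] -/
theorem EquidistributedModOne.congr {v : ℕ → ℝ} (hu : EquidistributedModOne u)
    (huv : ∀ᶠ n in atTop, u n = v n) : EquidistributedModOne v := by
  rw [equidistributedModOne_iff_weyl] at hu ⊢
  intro h hh
  obtain ⟨n₀, hn₀⟩ := eventually_atTop.1 huv
  set e : (ℕ → ℝ) → ℕ → ℂ := fun w n =>
    Complex.exp (2 * Real.pi * Complex.I * (((h : ℝ) * w n : ℝ) : ℂ)) with he
  -- the two partial sums differ, for `N ≥ n₀`, by the constant `Σ_{n<n₀} (e v - e u)`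
  have hdiff : ∀ᶠ N in atTop, ∑ n ∈ Finset.range N, e v n =
      ∑ n ∈ Finset.range N, e u n + ∑ n ∈ Finset.range n₀, (e v n - e u n) := by
    filter_upwards [eventually_ge_atTop n₀] with N hN
    rw [← Finset.sum_range_add_sum_Ico _ hN, ← Finset.sum_range_add_sum_Ico _ hN,
      Finset.sum_sub_distrib]
    have : ∑ n ∈ Finset.Ico n₀ N, e v n = ∑ n ∈ Finset.Ico n₀ N, e u n :=
      Finset.sum_congr rfl fun n hn => by simp only [he, hn₀ n (Finset.mem_Ico.1 hn).1]
    rw [this]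
    ring
  refine (IsLittleO.congr' ((hu h hh).add ?_) (hdiff.mono fun N hN => hN.symm)
    EventuallyEq.rfl)
  -- a constant is `o(N)`
  refine isLittleO_const_left.2 (Or.inr ?_)
  exact tendsto_norm_atTop_atTop.comp tendsto_natCast_atTop_atTop

/-- **Dropping initial terms**: if `u` is u.d. mod 1, so is `n ↦ u (n + k)`. [folklore] -/
theorem EquidistributedModOne.comp_add (hu : EquidistributedModOne u) (k : ℕ) :
    EquidistributedModOne fun n => u (n + k) := by
  rw [equidistributedModOne_iff_weyl] at hu ⊢
  intro h hh
  set e : ℕ → ℂ := fun n => Complex.exp (2 * Real.pi * Complex.I * (((h : ℝ) * u n : ℝ) : ℂ)) with he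
  have hrw : ∀ N, ∑ n ∈ Finset.range N, e (n + k) =
      ∑ n ∈ Finset.range (N + k), e n - ∑ n ∈ Finset.range k, e n := by
    intro N
    rw [eq_sub_iff_add_eq, add_comm, ← Finset.sum_range_add_sum_Ico _ (Nat.le_add_left k N),
      Finset.sum_Ico_eq_sum_range, Nat.add_sub_cancel]
    refine congrArg _ (Finset.sum_congr rfl fun n _ => by rw [add_comm])
  change (fun N : ℕ => ∑ n ∈ Finset.range N, e (n + k)) =o[atTop] fun N : ℕ => (N : ℝ)
  simp_rw [hrw]
  refine IsLittleO.sub ?_ ?_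
  · -- `S(N + k) = o(N + k) = o(N)`
    have h1 : (fun N : ℕ => ∑ n ∈ Finset.range (N + k), e n) =o[atTop] fun N : ℕ => ((N + k : ℕ) : ℝ) :=
      (hu h hh).comp_tendsto (tendsto_add_atTop_nat k)
    refine h1.trans_isBigO ?_
    refine IsBigO.of_bound 2 ?_
    filter_upwards [eventually_ge_atTop k] with N hN
    rw [Real.norm_natCast, Real.norm_natCast]
    push_cast
    have : (k : ℝ) ≤ N := by exact_mod_cast hN
    linarith
  · refine isLittleO_const_left.2 (Or.inr ?_)
    exact tendsto_norm_atTop_atTop.comp tendsto_natCast_atTop_atTop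

/-! ### Example 2.1: `nθ` for irrational `θ` -/

/-- **Weyl's equidistribution theorem for `nθ`** (K–N Example 2.1; Weyl 1916, §1): for irrational
`θ` and any real `c`, the sequence `(nθ + c)_n` is u.d. mod 1. Proof: the Weyl sums are geometric
sums with ratio `e(hθ) ≠ 1`, hence bounded. [cite: KuipersNiederreiter1974, Ch. 1, Example 2.1] -/
theorem equidistributedModOne_nat_mul_add {θ : ℝ} (hθ : Irrational θ) (c : ℝ) :
    EquidistributedModOne fun n : ℕ => n * θ + c := by
  refine EquidistributedModOne.add_const ?_ c
  rw [equidistributedModOne_iff_weyl]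
  intro h hh
  set q : ℂ := Complex.exp (2 * Real.pi * Complex.I * (((h : ℝ) * θ : ℝ) : ℂ)) with hq
  have hq1 : q ≠ 1 := by
    rw [hq]
    intro h1
    obtain ⟨m, hm⟩ := Complex.exp_eq_one_iff.1 h1
    have h2 : ((h : ℝ) * θ : ℂ) = (m : ℂ) := by
      have h2πI : (2 * Real.pi * Complex.I : ℂ) ≠ 0 := by
        refine mul_ne_zero (mul_ne_zero two_ne_zero ?_) Complex.I_ne_zero
        exact_mod_cast Real.pi_ne_zero
      have : (2 * Real.pi * Complex.I) * (((h : ℝ) * θ : ℝ) : ℂ) = (2 * Real.pi * Complex.I) * (m : ℂ) := by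
        rw [hm]; ring
      have := mul_left_cancel₀ h2πI this
      exact_mod_cast this
    have h3 : (h : ℝ) * θ = m := by exact_mod_cast h2
    exact (hθ.intCast_mul hh).ne_int m h3
  have hgeom : ∀ N : ℕ, ∑ n ∈ Finset.range N,
      Complex.exp (2 * Real.pi * Complex.I * (((h : ℝ) * ((n : ℝ) * θ) : ℝ) : ℂ)) = (q ^ N - 1) / (q - 1) := by
    intro N
    rw [← geom_sum_eq hq1]
    refine Finset.sum_congr rfl fun n _ => ?_
    rw [hq, ← Complex.exp_nat_mul]
    congr 1
    push_cast
    ring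
  simp_rw [hgeom]
  -- the geometric sums are bounded by `2/‖q - 1‖`, a constant is `o(N)`
  have hbound : ∀ N : ℕ, ‖(q ^ N - 1) / (q - 1)‖ ≤ 2 / ‖q - 1‖ := by
    intro N
    rw [norm_div]
    gcongr
    refine (norm_sub_le _ _).trans ?_
    have hqn : ‖q‖ = 1 := by
      rw [hq, Complex.norm_exp]
      simp
    rw [norm_pow, hqn, one_pow, norm_one]
    norm_num
  refine IsLittleO.of_bound fun ε hε => ?_
  have hq0 : 0 < ‖q - 1‖ := norm_pos_iff.2 (sub_ne_zero.2 hq1)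
  filter_upwards [eventually_ge_atTop ⌈2 / ‖q - 1‖ / ε⌉₊] with N hN
  refine (hbound N).trans ?_
  rw [Real.norm_natCast]
  have hN' : 2 / ‖q - 1‖ / ε ≤ N := (Nat.le_ceil _).trans (by exact_mod_cast hN)
  rw [mul_comm]
  exact (div_le_iff₀ hε).1 hN'

/-- **Weyl's equidistribution theorem**: `(nθ)_n` is u.d. mod 1 for irrational `θ`.
[cite: KuipersNiederreiter1974, Ch. 1, Example 2.1] -/
theorem equidistributedModOne_nat_mul {θ : ℝ} (hθ : Irrational θ) :
    EquidistributedModOne fun n : ℕ => n * θ := by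
  simpa using equidistributedModOne_nat_mul_add hθ 0

end Literature.NumberTheory.UniformDistribution

end
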